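import Summits.Ventures.HodgeRepro2.T5HeckeInvariantsDetermine
import Summits.Ventures.HodgeRepro2.T5HeckeCommutativeMultiplicityOne

/-!
# The Hecke eigencharacter determines the representation (commutative `H(G, K)`)

Kernel annex of the Tier-5 record (blind lane).  For a commutative Hecke algebra `H(G, K)`
(`T5HeckeCommutativeMultiplicityOne`: the Satake commutativity for hyperspecial `K` enters ONLY as
the hypothesis `hcomm`), an irreducible `K`-finite representation `ρ` with `ρ^K ≠ 0` has a
one-dimensional `ρ^K` on which `H(G, K)` acts through the eigencharacter
`heckeCharacter ρ … : H(G, K) → k`.  This file records the sentence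

  «an unramified irreducible representation is determined by its Hecke eigencharacter
   (its Satake parameter)»

in kernel form:

* `nonempty_equiv_of_heckeCharacter_eq` — two such representations `ρ`, `ρ'` with the SAME
  eigencharacter are isomorphic: any linear isomorphism `ρ^K ≃ ρ'^K` of the two lines is
  Hecke-equivariant (both sides act by the same scalar), and `T5HeckeInvariantsDetermine`
  (an injective Hecke-equivariant map between the `K`-invariants of irreducibles forces an
  isomorphism) applies;
* `heckeCharacter_eq_of_equiv` — conversely, isomorphic representations have the same
  eigencharacter (the isomorphism restricts to a Hecke-equivariant map of the `K`-invariants,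
  `T5HeckePermutationModule.invariantsMap_heckeSMul`);
* `nonempty_equiv_iff_heckeCharacter_eq` — the two together.

What stays prose: the commutativity of the specific `H(G, K)` (Satake; its elementary half is
`T5HeckeGelfandTrick` / `T5HeckeGelfandTrickGeneral`), the identification of the eigencharacter with
the Satake parameter, and the printed theorems.
-/

namespace Summit.Ventures.HodgeRepro2.T5HeckeEigencharacterDetermines

open T5HeckePermutationModule T5HeckeCommutativeMultiplicityOne T5HeckeInvariantsDetermine
  LevelPositivity

variable {G : Type*} [Group G] {k : Type*} [Field k]
  {V : Type*} [AddCommGroup V] [Module k V] {V' : Type*} [AddCommGroup V'] [Module k V']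
  (ρ : Representation k G V) (ρ' : Representation k G V') {K : Subgroup G}
  [CharZero k] [ρ.IsIrreducible] [ρ'.IsIrreducible] [IsAlgClosed k]

omit [CharZero k] [ρ.IsIrreducible] [IsAlgClosed k] in
/-- A non-zero vector of the subtype `ρ^K` from `ρ^K ≠ ⊥`. -/
theorem exists_ne_zero_of_ne_bot (hne : invariants ρ K ≠ ⊥) :
    ∃ v : invariants ρ K, v ≠ 0 := by
  obtain ⟨x, hx, hx0⟩ := (Submodule.ne_bot_iff _).1 hne
  exact ⟨⟨x, hx⟩, fun h => hx0 ((Submodule.mk_eq_zero _ hx).1 h)⟩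

/-- A `k`-linear map between the `K`-invariants of two representations with the same Hecke
eigencharacter is automatically `H(G, K)`-equivariant: both sides act by the scalar
`heckeCharacter T`. -/
theorem heckeSMul_map_of_heckeCharacter_eq
    (hK : T5LevelIdempotent.KFinite ρ K) (hK' : T5LevelIdempotent.KFinite ρ' K)
    (hfin : ∀ g : G, Finite (MulAction.orbit K (g : G ⧸ K)))
    [FiniteDimensional k (invariants ρ K)] [FiniteDimensional k (invariants ρ' K)]
    (hne : invariants ρ K ≠ ⊥) (hne' : invariants ρ' K ≠ ⊥)
    (hcomm : ∀ T S : heckeAlgebra k K, T * S = S * T)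
    (hχ : ∀ T : heckeAlgebra k K,
      heckeCharacter ρ hK hfin hne hcomm T = heckeCharacter ρ' hK' hfin hne' hcomm T)
    (φ : invariants ρ K →ₗ[k] invariants ρ' K) (T : heckeAlgebra k K) (m : invariants ρ K) :
    φ (heckeSMul ρ T m) = heckeSMul ρ' T (φ m) := by
  rw [heckeSMul_eq_heckeCharacter_smul ρ hK hfin hne hcomm,
    heckeSMul_eq_heckeCharacter_smul ρ' hK' hfin hne' hcomm, map_smul, hχ]

/-- **The Hecke eigencharacter determines the representation.**  For commutative `H(G, K)`, two
irreducible `K`-finite representations with non-zero, finite-dimensional `K`-invariants and the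
SAME eigencharacter are isomorphic. -/
theorem nonempty_equiv_of_heckeCharacter_eq
    (hK : T5LevelIdempotent.KFinite ρ K) (hK' : T5LevelIdempotent.KFinite ρ' K)
    (hfin : ∀ g : G, Finite (MulAction.orbit K (g : G ⧸ K)))
    [FiniteDimensional k (invariants ρ K)] [FiniteDimensional k (invariants ρ' K)]
    (hne : invariants ρ K ≠ ⊥) (hne' : invariants ρ' K ≠ ⊥)
    (hcomm : ∀ T S : heckeAlgebra k K, T * S = S * T)
    (hχ : ∀ T : heckeAlgebra k K,
      heckeCharacter ρ hK hfin hne hcomm T = heckeCharacter ρ' hK' hfin hne' hcomm T) :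
    Nonempty (ρ.Equiv ρ') := by
  have h1 : Module.finrank k (invariants ρ K) = Module.finrank k (invariants ρ' K) := by
    rw [finrank_invariants_eq_one ρ hK hfin hne hcomm,
      finrank_invariants_eq_one ρ' hK' hfin hne' hcomm]
  let e : invariants ρ K ≃ₗ[k] invariants ρ' K :=
    LinearEquiv.ofFinrankEq (invariants ρ K) (invariants ρ' K) h1
  obtain ⟨v₀, hv₀⟩ := exists_ne_zero_of_ne_bot ρ hne
  exact nonempty_equiv_of_injective_heckeEquivariant ρ ρ' (e : invariants ρ K →ₗ[k] invariants ρ' K)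
    hK hK' hfin e.injective
    (heckeSMul_map_of_heckeCharacter_eq ρ ρ' hK hK' hfin hne hne' hcomm hχ _) hv₀

omit [CharZero k] [ρ.IsIrreducible] [ρ'.IsIrreducible] [IsAlgClosed k] in
/-- An isomorphism of representations intertwines `ρ` and `ρ'` pointwise (the form needed by
`invariantsMap`). -/
theorem equiv_intertwining (e : ρ.Equiv ρ') (g : G) (v : V) :
    e.toLinearEquiv (ρ g v) = ρ' g (e.toLinearEquiv v) := by
  have h := LinearMap.congr_fun (e.toIntertwiningMap.isIntertwining' g) v
  rw [LinearMap.comp_apply, LinearMap.comp_apply] at h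
  exact h

omit [CharZero k] [ρ.IsIrreducible] [ρ'.IsIrreducible] [IsAlgClosed k] in
/-- The restriction of an isomorphism `ρ ≅ ρ'` to the `K`-invariants is injective. -/
theorem invariantsMap_equiv_injective (e : ρ.Equiv ρ') :
    Function.Injective
      (T5LevelIdempotentNaturality.invariantsMap (e.toLinearEquiv : V →ₗ[k] V')
        (equiv_intertwining ρ ρ' e) K) := by
  intro m m' h
  apply Subtype.ext
  have h' := congrArg Subtype.val h
  exact e.toLinearEquiv.injective h'

/-- Conversely, isomorphic representations have the same Hecke eigencharacter. -/
theorem heckeCharacter_eq_of_equiv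
    (hK : T5LevelIdempotent.KFinite ρ K) (hK' : T5LevelIdempotent.KFinite ρ' K)
    (hfin : ∀ g : G, Finite (MulAction.orbit K (g : G ⧸ K)))
    [FiniteDimensional k (invariants ρ K)] [FiniteDimensional k (invariants ρ' K)]
    (hne : invariants ρ K ≠ ⊥) (hne' : invariants ρ' K ≠ ⊥)
    (hcomm : ∀ T S : heckeAlgebra k K, T * S = S * T)
    (e : ρ.Equiv ρ') (T : heckeAlgebra k K) :
    heckeCharacter ρ hK hfin hne hcomm T = heckeCharacter ρ' hK' hfin hne' hcomm T := by
  obtain ⟨v₀, hv₀⟩ := exists_ne_zero_of_ne_bot ρ hne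
  set Φ := T5LevelIdempotentNaturality.invariantsMap (e.toLinearEquiv : V →ₗ[k] V')
    (equiv_intertwining ρ ρ' e) K with hΦ
  have hw : Φ v₀ ≠ 0 := by
    intro h
    apply hv₀
    apply invariantsMap_equiv_injective ρ ρ' e
    rw [← hΦ, h, map_zero]
  have key : heckeSMul ρ' T (Φ v₀) = heckeCharacter ρ hK hfin hne hcomm T • Φ v₀ := by
    rw [← invariantsMap_heckeSMul ρ, heckeSMul_eq_heckeCharacter_smul ρ hK hfin hne hcomm, map_smul]
  exact (heckeCharacter_eq_of_smul_eq ρ' hK' hfin hne' hcomm hw key).symm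

/-- **Isomorphism classes of unramified irreducibles ↔ Hecke eigencharacters** (commutative
`H(G, K)`): two irreducible `K`-finite representations with non-zero finite-dimensional
`K`-invariants are isomorphic iff their Hecke eigencharacters agree. -/
theorem nonempty_equiv_iff_heckeCharacter_eq
    (hK : T5LevelIdempotent.KFinite ρ K) (hK' : T5LevelIdempotent.KFinite ρ' K)
    (hfin : ∀ g : G, Finite (MulAction.orbit K (g : G ⧸ K)))
    [FiniteDimensional k (invariants ρ K)] [FiniteDimensional k (invariants ρ' K)]
    (hne : invariants ρ K ≠ ⊥) (hne' : invariants ρ' K ≠ ⊥)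
    (hcomm : ∀ T S : heckeAlgebra k K, T * S = S * T) :
    Nonempty (ρ.Equiv ρ') ↔
      ∀ T : heckeAlgebra k K,
        heckeCharacter ρ hK hfin hne hcomm T = heckeCharacter ρ' hK' hfin hne' hcomm T :=
  ⟨fun ⟨e⟩ T => heckeCharacter_eq_of_equiv ρ ρ' hK hK' hfin hne hne' hcomm e T,
    fun hχ => nonempty_equiv_of_heckeCharacter_eq ρ ρ' hK hK' hfin hne hne' hcomm hχ⟩

/-- The same statement through the algebra homomorphisms `heckeCharacterAlgHom : H(G, K) →ₐ[k] k`. -/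
theorem nonempty_equiv_iff_heckeCharacterAlgHom_eq
    (hK : T5LevelIdempotent.KFinite ρ K) (hK' : T5LevelIdempotent.KFinite ρ' K)
    (hfin : ∀ g : G, Finite (MulAction.orbit K (g : G ⧸ K)))
    [FiniteDimensional k (invariants ρ K)] [FiniteDimensional k (invariants ρ' K)]
    (hne : invariants ρ K ≠ ⊥) (hne' : invariants ρ' K ≠ ⊥)
    (hcomm : ∀ T S : heckeAlgebra k K, T * S = S * T) :
    Nonempty (ρ.Equiv ρ') ↔
      heckeCharacterAlgHom ρ hK hfin hne hcomm = heckeCharacterAlgHom ρ' hK' hfin hne' hcomm := by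
  rw [nonempty_equiv_iff_heckeCharacter_eq ρ ρ' hK hK' hfin hne hne' hcomm]
  constructor
  · intro h
    ext T
    rw [heckeCharacterAlgHom_apply, heckeCharacterAlgHom_apply, h T]
  · intro h T
    rw [← heckeCharacterAlgHom_apply, ← heckeCharacterAlgHom_apply, h]

end Summit.Ventures.HodgeRepro2.T5HeckeEigencharacterDetermines
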